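import Summits.AtomisticToContinuum.HydrodynamicLimit.Theorems.CollisionIsometryCLTAdaptedWeightCLTCBPointwise
import Literature.MathematicalPhysics.KineticTheory.HardSphereEulerProofs
import Literature.MathematicalPhysics.KineticTheory.HydrodynamicLimitsMomentsProofs

/-!
# Equilibrium rung of the crux `AdaptedWeightCLT` (stmt-AtomisticToContinuum-14868), line `Sketch`:
# one-particle Gaussian inputs

Support file (`--supports stmt-AtomisticToContinuum-14868`, anchor `eqRung_gauss_anchor`) of the line lead
`prover-line-stmt-AtomisticToContinuum-14868-c3-0`. The EQUILIBRIUM RUNG of the crux says: at CONSTANT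
profiles `(a₀, u₀, θ₀) ≡ (a, u, θ)` the crux's conclusion `ConclOn` holds on every horizon `[0, t]`, for
every hard-sphere flow family, with no hypothesis at all (the local Gibbs law is then invariant, so the
conclusion is a STATIC statement about block velocity fluctuations, integrated in time). Given the
positions, the local Gibbs velocities are independent Gaussians `N(u, θ𝟙)`
(`Literature.MathematicalPhysics.KineticTheory.lintegral_localGibbsMeasure`); this file collects the
ONE-PARTICLE inputs of the static statement, all elementary consequences of Mathlib's Gaussian API
(`IsGaussian.memLp_id`, `covarianceBilin_stdGaussian` through the tree lemma
`integral_inner_mul_inner_stdGaussian`, isometry invariance through `integral_stdGaussian_eq_zero_of_odd_vec`):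

* moments of all orders `∫ ‖v − u‖^k dN(u, θ𝟙) < ∞` and domination (`integrable_of_le_pow`);
* centred second moments `∫ (v−u)_j (v−u)_l = θ δ_{jl}` (`integral_coord_sub_mul`);
* the crux's rank-2 traceless test `⟨C2 j l, y ⊗ y⟩ = y_j y_l − δ_{jl}|y|²/3` and rank-3 test
  `⟨C3 a, y^{⊗3}⟩ = ½ |y|² y_a` are CENTRED under `N(u, θ𝟙)` in `y = v − u`
  (`integral_pairT_C2_sub`, `integral_pairT_C3_sub`) — this is why the block traceless stress and the
  block heat flux of a local Gibbs state are pure fluctuations;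
* Cauchy–Schwarz for lower integrals of nonnegative real products (`lintegral_ofReal_mul_le`);
* under the product `⊗ᵢ N(u, θ𝟙)` of `N + 1` independent velocities: one-particle observables integrate as
  under `N(u, θ𝟙)` (`lintegral_comp_eval`) and the weighted moment sums `P_m = Σ cᵢ ‖vᵢ − u‖^m` of convex
  weights satisfy Jensen `P_m^n ≤ P_{mn}` and `E P_m^n ≤ m_{mn}` (`P_pow_le`, `lintegral_P_pow_le`; the
  function `P` enters with its defining equation as a hypothesis, no definition is made).

No definitions are introduced (pure proof file).

References: H. Spohn, *Large Scale Dynamics of Interacting Particles* (1991), Part I §2.3 (local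
equilibrium states: given the positions the velocities are independent Maxwellians) [Spohn1991].
-/

namespace Summit.AtomisticToContinuum.HydrodynamicLimit.Theorems.ContactBalance

open scoped BigOperators Topology Classical MeasureTheory ENNReal InnerProductSpace
open Filter Set MeasureTheory ProbabilityTheory
open Literature.Analysis.FluidPDE
open Summit.AtomisticToContinuum.HydrodynamicLimit.Theorems.ContactSourceDuhamel
open Summit.AtomisticToContinuum.HydrodynamicLimit.Theorems.ContactSourceDuhamel.TimeLocal
open Literature.MathematicalPhysics.KineticTheory (gaussMeasure integral_gaussMeasure
  variance_coord_gaussMeasure integral_coord_gaussMeasure memLp_coord_gaussMeasure)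

noncomputable section

namespace EqRung

/-! ## Cauchy–Schwarz for lower integrals -/

/-- Cauchy–Schwarz for lower integrals of real nonnegative products:
`∫⁻ (a b) ≤ (∫⁻ a²)^{1/2} (∫⁻ b²)^{1/2}`. -/
theorem lintegral_ofReal_mul_le {Ω : Type*} [MeasurableSpace Ω] (μ : Measure Ω) {a b : Ω → ℝ}
    (ha : Measurable a) (hb : Measurable b) (ha0 : ∀ ω, 0 ≤ a ω) (hb0 : ∀ ω, 0 ≤ b ω) :
    ∫⁻ ω, ENNReal.ofReal (a ω * b ω) ∂μ ≤
      (∫⁻ ω, ENNReal.ofReal (a ω ^ 2) ∂μ) ^ (1 / 2 : ℝ) * (∫⁻ ω, ENNReal.ofReal (b ω ^ 2) ∂μ) ^ (1 / 2 : ℝ) := by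
  have h := ENNReal.lintegral_mul_le_Lp_mul_Lq μ Real.HolderConjugate.two_two
    ha.ennreal_ofReal.aemeasurable hb.ennreal_ofReal.aemeasurable
  have e1 : (fun ω => ENNReal.ofReal (a ω)) * (fun ω => ENNReal.ofReal (b ω)) =
      fun ω => ENNReal.ofReal (a ω * b ω) := by
    funext ω
    simp only [Pi.mul_apply]
    rw [ENNReal.ofReal_mul (ha0 ω)]
  have e2 : ∀ (f : Ω → ℝ), (∀ ω, 0 ≤ f ω) →
      (fun ω => ENNReal.ofReal (f ω) ^ (2 : ℝ)) = fun ω => ENNReal.ofReal (f ω ^ 2) := by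
    intro f hf
    funext ω
    rw [ENNReal.rpow_two, ← ENNReal.ofReal_pow (hf ω)]
  rw [e1, e2 a ha0, e2 b hb0] at h
  exact h

/-! ## One particle: moments and centring under `N(u, θ𝟙)` -/

section OneParticle

variable (u : V3) (θ : ℝ)

/-- `(1 + ‖v − u‖)^k` is integrable under `N(u, θ𝟙)` (Gaussian measures have all moments). -/
theorem integrable_one_add_norm_sub_pow (k : ℕ) :
    Integrable (fun v : V3 => (1 + ‖v - u‖) ^ k) (gaussMeasure u θ) := by
  have h0 : MemLp (fun v : V3 => ‖v - u‖) (k : ℝ≥0∞) (gaussMeasure u θ) := by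
    have h : MemLp (fun v : V3 => v - u) (k : ℝ≥0∞) (gaussMeasure u θ) :=
      (IsGaussian.memLp_id (gaussMeasure u θ) k (ENNReal.natCast_ne_top k)).sub (memLp_const u)
    exact h.norm
  have h1 : MemLp (fun v : V3 => 1 + ‖v - u‖) (k : ℝ≥0∞) (gaussMeasure u θ) :=
    (memLp_const (1 : ℝ)).add h0
  refine h1.integrable_norm_pow'.congr (ae_of_all _ fun v => ?_)
  change ‖1 + ‖v - u‖‖ ^ k = (1 + ‖v - u‖) ^ k
  rw [Real.norm_of_nonneg (by positivity)]

/-- A continuous function dominated by `C (1 + ‖v − u‖)^k` is integrable under `N(u, θ𝟙)`. -/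
theorem integrable_of_le_pow {g : V3 → ℝ} (hg : Continuous g) {C : ℝ} {k : ℕ}
    (hle : ∀ v, |g v| ≤ C * (1 + ‖v - u‖) ^ k) : Integrable g (gaussMeasure u θ) :=
  Integrable.mono' ((integrable_one_add_norm_sub_pow u θ k).const_mul C) hg.aestronglyMeasurable
    (ae_of_all _ fun v => by rw [Real.norm_eq_abs]; exact hle v)

/-- `‖v − u‖^k` is integrable under `N(u, θ𝟙)`. -/
theorem integrable_norm_sub_pow (k : ℕ) :
    Integrable (fun v : V3 => ‖v - u‖ ^ k) (gaussMeasure u θ) := by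
  have hc : Continuous fun v : V3 => ‖v - u‖ ^ k := by fun_prop
  refine integrable_of_le_pow u θ hc (C := 1) (k := k) fun v => ?_
  rw [abs_of_nonneg (by positivity), one_mul]
  exact pow_le_pow_left₀ (norm_nonneg _) (by linarith [norm_nonneg (v - u)]) k

/-- Moments are nonnegative. -/
theorem integral_norm_sub_pow_nonneg (k : ℕ) : 0 ≤ ∫ v, ‖v - u‖ ^ k ∂gaussMeasure u θ :=
  integral_nonneg fun v => by positivity

/-- The moments as lower Lebesgue integrals. -/
theorem lintegral_norm_sub_pow (k : ℕ) :
    ∫⁻ v, ENNReal.ofReal (‖v - u‖ ^ k) ∂gaussMeasure u θ =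
      ENNReal.ofReal (∫ v, ‖v - u‖ ^ k ∂gaussMeasure u θ) := by
  rw [ofReal_integral_eq_lintegral_ofReal (integrable_norm_sub_pow u θ k)
    (ae_of_all _ fun v => by positivity)]

variable {θ}

/-- Centred second moments: `∫ (v − u)_j (v − u)_l dN(u, θ𝟙) = θ δ_{jl}`. -/
theorem integral_coord_sub_mul (hθ : 0 < θ) (j l : Fin 3) :
    ∫ v, (v - u) j * (v - u) l ∂gaussMeasure u θ = if j = l then θ else 0 := by
  rw [integral_gaussMeasure u hθ]
  have hs : Real.sqrt θ * Real.sqrt θ = θ := Real.mul_self_sqrt hθ.le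
  have h1 : ∀ w : V3, (u + Real.sqrt θ • w - u) j * (u + Real.sqrt θ • w - u) l =
      θ * (⟪EuclideanSpace.single j (1 : ℝ), w⟫_ℝ * ⟪EuclideanSpace.single l (1 : ℝ), w⟫_ℝ) := by
    intro w
    rw [EuclideanSpace.inner_single_left, EuclideanSpace.inner_single_left, add_sub_cancel_left]
    simp only [map_one, one_mul, WithLp.ofLp_smul, Pi.smul_apply, smul_eq_mul]
    linear_combination (w j * w l) * hs
  simp_rw [h1]
  rw [integral_const_mul,
    Literature.MathematicalPhysics.KineticTheory.integral_inner_mul_inner_stdGaussian,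
    EuclideanSpace.inner_single_left, map_one, one_mul, PiLp.single_apply]
  split_ifs <;> simp

/-- Products of centred coordinates are integrable under `N(u, θ𝟙)`. -/
theorem integrable_coord_sub_mul (i i' : Fin 3) :
    Integrable (fun v : V3 => (v - u) i * (v - u) i') (gaussMeasure u θ) := by
  have hc := fun (z : V3) (n : Fin 3) =>
    (show |z n| ≤ ‖z‖ by simpa only [Real.norm_eq_abs] using PiLp.norm_apply_le z n)
  have hcont : Continuous fun v : V3 => (v - u) i * (v - u) i' := by fun_prop
  refine integrable_of_le_pow u θ hcont (C := 1) (k := 2) fun v => ?_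
  rw [abs_mul, one_mul]
  calc |(v - u) i| * |(v - u) i'| ≤ ‖v - u‖ * ‖v - u‖ :=
        mul_le_mul (hc _ i) (hc _ i') (abs_nonneg _) (norm_nonneg _)
    _ ≤ (1 + ‖v - u‖) ^ 2 := by nlinarith [norm_nonneg (v - u)]

/-- The rank-2 traceless test is centred under `N(u, θ𝟙)`: `∫ ⟨C2 j l, (v−u)⊗(v−u)⟩ = 0`. -/
theorem integral_pairT_C2_sub (hθ : 0 < θ) (j l : Fin 3) :
    ∫ v, pairT (C2 j l) (tpow 2 (v - u)) ∂gaussMeasure u θ = 0 := by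
  simp_rw [Reduction.pairT_C2_tpow]
  have hprod := integrable_coord_sub_mul u (θ := θ)
  have hsq : ∀ i : Fin 3, Integrable (fun v : V3 => (v - u) i ^ 2) (gaussMeasure u θ) := fun i => by
    simpa only [sq] using hprod i i
  have hsum : Integrable (fun v : V3 => (∑ i : Fin 3, (v - u) i ^ 2) / 3) (gaussMeasure u θ) :=
    (integrable_finsetSum _ fun i _ => hsq i).div_const 3
  by_cases hjl : j = l
  · subst hjl
    simp only [if_true]
    rw [integral_sub (hprod j j) hsum, integral_div, integral_finsetSum _ fun i _ => hsq i]
    simp_rw [sq, integral_coord_sub_mul u hθ, if_true]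
    simp only [Finset.sum_const, Finset.card_univ, Fintype.card_fin, nsmul_eq_mul, Nat.cast_ofNat]
    ring
  · simp only [hjl, if_false, sub_zero]
    rw [integral_coord_sub_mul u hθ, if_neg hjl]

/-- The rank-3 test is centred under `N(u, θ𝟙)` (it is odd): `∫ ⟨C3 a, (v−u)^{⊗3}⟩ = 0`. -/
theorem integral_pairT_C3_sub (hθ : 0 < θ) (a : Fin 3) :
    ∫ v, pairT (C3 a) (tpow 3 (v - u)) ∂gaussMeasure u θ = 0 := by
  rw [integral_gaussMeasure u hθ]
  simp_rw [add_sub_cancel_left]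
  refine Literature.MathematicalPhysics.KineticTheory.integral_stdGaussian_eq_zero_of_odd_vec
    (LinearIsometryEquiv.neg ℝ) fun w => ?_
  rw [Reduction.pairT_C3_tpow, Reduction.pairT_C3_tpow]
  simp only [LinearIsometryEquiv.coe_neg, smul_neg, WithLp.ofLp_neg, Pi.neg_apply]
  ring

/-- The square bound `f(y)² ≤ 4 (1 + ‖y‖)^{2(k+1)}` for a test with `|f y| ≤ 2 ‖y‖^{k+1}`. -/
theorem sq_le_of_abs_le_two_mul_pow {f : V3 → ℝ} {k : ℕ} (hf0 : ∀ y, |f y| ≤ 2 * ‖y‖ ^ (k + 1)) (y : V3) :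
    f y ^ 2 ≤ 4 * (1 + ‖y‖) ^ (2 * (k + 1)) := by
  have h1 : f y ^ 2 ≤ (2 * ‖y‖ ^ (k + 1)) ^ 2 := by
    rw [← sq_abs]; exact pow_le_pow_left₀ (abs_nonneg _) (hf0 y) 2
  calc f y ^ 2 ≤ (2 * ‖y‖ ^ (k + 1)) ^ 2 := h1
    _ = 4 * ‖y‖ ^ (2 * (k + 1)) := by ring
    _ ≤ 4 * (1 + ‖y‖) ^ (2 * (k + 1)) := by
        gcongr
        linarith [norm_nonneg y]

/-- A continuous test with `|f y| ≤ 2 ‖y‖^{k+1}` is square integrable under `N(u, θ𝟙)` in `y = v − u`. -/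
theorem memLp_two_f_sub {f : V3 → ℝ} (hf : Continuous f) {k : ℕ} (hf0 : ∀ y, |f y| ≤ 2 * ‖y‖ ^ (k + 1)) :
    MemLp (fun w : V3 => f (w - u)) 2 (gaussMeasure u θ) := by
  have hcont : Continuous (fun w : V3 => f (w - u)) := hf.comp (continuous_id.sub continuous_const)
  have hcont2 : Continuous (fun w : V3 => f (w - u) ^ 2) := hcont.pow 2
  rw [memLp_two_iff_integrable_sq hcont.aestronglyMeasurable]
  refine integrable_of_le_pow u θ hcont2 (C := 4) (k := 2 * (k + 1)) fun v => ?_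
  rw [abs_of_nonneg (sq_nonneg _)]
  exact sq_le_of_abs_le_two_mul_pow hf0 (v - u)

/-- The one-particle variance bound `Var f(· − u) ≤ 4 m_{2k+2}` for a centred continuous test with
`|f y| ≤ 2 ‖y‖^{k+1}`. -/
theorem variance_f_sub_le {f : V3 → ℝ} (hf : Continuous f) {k : ℕ} (hf0 : ∀ y, |f y| ≤ 2 * ‖y‖ ^ (k + 1))
    (hmean : ∫ w, f (w - u) ∂gaussMeasure u θ = 0) :
    Var[fun w : V3 => f (w - u); gaussMeasure u θ] ≤
      4 * ∫ w, ‖w - u‖ ^ (2 * (k + 1)) ∂gaussMeasure u θ := by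
  have h2 : MemLp (fun w : V3 => f (w - u)) 2 (gaussMeasure u θ) := memLp_two_f_sub u hf hf0
  have hint2 : ∫ w, f (w - u) ^ 2 ∂gaussMeasure u θ ≤ 4 * ∫ w, ‖w - u‖ ^ (2 * (k + 1)) ∂gaussMeasure u θ := by
    calc ∫ w, f (w - u) ^ 2 ∂gaussMeasure u θ
        ≤ ∫ w, 4 * ‖w - u‖ ^ (2 * (k + 1)) ∂gaussMeasure u θ := by
          refine integral_mono h2.integrable_sq ((integrable_norm_sub_pow u θ _).const_mul 4) fun w => ?_
          have h1 : f (w - u) ^ 2 ≤ (2 * ‖w - u‖ ^ (k + 1)) ^ 2 := by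
            rw [← sq_abs]; exact pow_le_pow_left₀ (abs_nonneg _) (hf0 (w - u)) 2
          calc f (w - u) ^ 2 ≤ (2 * ‖w - u‖ ^ (k + 1)) ^ 2 := h1
            _ = 4 * ‖w - u‖ ^ (2 * (k + 1)) := by ring
      _ = 4 * ∫ w, ‖w - u‖ ^ (2 * (k + 1)) ∂gaussMeasure u θ := integral_const_mul _ _
  have hv2 := variance_eq_sub h2
  simp only [Pi.pow_apply] at hv2
  rw [hmean] at hv2
  simp only [ne_eq, OfNat.ofNat_ne_zero, not_false_eq_true, zero_pow, sub_zero] at hv2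
  rw [hv2]
  exact hint2

end OneParticle

/-! ## Independent particles: one-particle observables and the weighted moment sums `P_m` -/

section ProductBasics

variable (u : V3) (θ : ℝ) {N : ℕ}

/-- One-particle observables integrate under the product as under `N(u, θ𝟙)` (lower integrals). -/
theorem lintegral_comp_eval (i : Fin (N + 1)) {g : V3 → ℝ≥0∞} (hg : Measurable g) :
    ∫⁻ v, g (v i) ∂(Measure.pi (fun _ : Fin (N + 1) => gaussMeasure u θ)) = ∫⁻ w, g w ∂gaussMeasure u θ :=
  (measurePreserving_eval (fun _ : Fin (N + 1) => gaussMeasure u θ) i).lintegral_comp hg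

variable (c : Fin (N + 1) → ℝ)

/-! ## The weighted moment sums `P_m = Σᵢ cᵢ ‖vᵢ − u‖^m` -/

section Psums

variable (P : ℕ → (Fin (N + 1) → V3) → ℝ)

/-- `P_m ≥ 0`. -/
theorem P_nonneg (hc0 : ∀ i, 0 ≤ c i) (hP : P = fun m v => ∑ i, c i * ‖v i - u‖ ^ m) (m : ℕ)
    (v : Fin (N + 1) → V3) : 0 ≤ P m v := by
  subst hP
  exact Finset.sum_nonneg fun i _ => mul_nonneg (hc0 i) (by positivity)

/-- `P_m` is continuous. -/
theorem continuous_P (hP : P = fun m v => ∑ i, c i * ‖v i - u‖ ^ m) (m : ℕ) : Continuous (P m) := by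
  subst hP; fun_prop

/-- `E P_m = m_m Σ cᵢ` (linearity and identical marginals), as lower integrals. -/
theorem lintegral_P (hc0 : ∀ i, 0 ≤ c i) (hP : P = fun m v => ∑ i, c i * ‖v i - u‖ ^ m) (m : ℕ) :
    ∫⁻ v, ENNReal.ofReal (P m v) ∂(Measure.pi (fun _ : Fin (N + 1) => gaussMeasure u θ)) =
      ENNReal.ofReal ((∑ i, c i) * ∫ w, ‖w - u‖ ^ m ∂gaussMeasure u θ) := by
  have hmom := integral_norm_sub_pow_nonneg u θ m
  have hmi : ∀ i : Fin (N + 1), Measurable (fun v : Fin (N + 1) → V3 => ENNReal.ofReal (‖v i - u‖ ^ m)) :=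
    fun i => (by fun_prop : Continuous fun v : Fin (N + 1) → V3 => ‖v i - u‖ ^ m).measurable.ennreal_ofReal
  have hmi' : ∀ i : Fin (N + 1), Measurable (fun v : Fin (N + 1) → V3 =>
      ENNReal.ofReal (c i) * ENNReal.ofReal (‖v i - u‖ ^ m)) := fun i => (hmi i).const_mul _
  have hg : Measurable (fun w : V3 => ENNReal.ofReal (‖w - u‖ ^ m)) :=
    (by fun_prop : Continuous fun w : V3 => ‖w - u‖ ^ m).measurable.ennreal_ofReal
  have e1 : (fun v : Fin (N + 1) → V3 => ENNReal.ofReal (P m v)) =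
      fun v => ∑ i, ENNReal.ofReal (c i) * ENNReal.ofReal (‖v i - u‖ ^ m) := by
    funext v
    subst hP
    dsimp only
    rw [ENNReal.ofReal_sum_of_nonneg fun i _ => mul_nonneg (hc0 i) (by positivity)]
    exact Finset.sum_congr rfl fun i _ => ENNReal.ofReal_mul (hc0 i)
  rw [e1, lintegral_finsetSum _ fun i _ => hmi' i, Finset.sum_mul,
    ENNReal.ofReal_sum_of_nonneg fun i _ => mul_nonneg (hc0 i) hmom]
  refine Finset.sum_congr rfl fun i _ => ?_
  rw [lintegral_const_mul _ (hmi i), ENNReal.ofReal_mul (hc0 i)]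
  congr 1
  calc ∫⁻ v, ENNReal.ofReal (‖v i - u‖ ^ m) ∂(Measure.pi (fun _ : Fin (N + 1) => gaussMeasure u θ))
      = ∫⁻ w, ENNReal.ofReal (‖w - u‖ ^ m) ∂gaussMeasure u θ := lintegral_comp_eval u θ i hg
    _ = _ := lintegral_norm_sub_pow u θ m

/-- Jensen: `P_m^n ≤ P_{m n}` for convex weights. -/
theorem P_pow_le (hc0 : ∀ i, 0 ≤ c i) (hc1 : ∑ i, c i = 1)
    (hP : P = fun m v => ∑ i, c i * ‖v i - u‖ ^ m) (m n : ℕ) (v : Fin (N + 1) → V3) :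
    P m v ^ n ≤ P (m * n) v := by
  subst hP
  dsimp only
  calc (∑ i, c i * ‖v i - u‖ ^ m) ^ n ≤ ∑ i, c i * (‖v i - u‖ ^ m) ^ n :=
        Real.pow_arith_mean_le_arith_mean_pow Finset.univ c (fun i => ‖v i - u‖ ^ m)
          (fun i _ => hc0 i) hc1 (fun i _ => by positivity) n
    _ = ∑ i, c i * ‖v i - u‖ ^ (m * n) := by
        refine Finset.sum_congr rfl fun i _ => ?_
        rw [← pow_mul]

/-- `E P_m^n ≤ m_{mn}` for convex weights (Jensen, then linearity). -/
theorem lintegral_P_pow_le (hc0 : ∀ i, 0 ≤ c i) (hc1 : ∑ i, c i = 1)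
    (hP : P = fun m v => ∑ i, c i * ‖v i - u‖ ^ m) (m n : ℕ) :
    ∫⁻ v, ENNReal.ofReal (P m v ^ n) ∂(Measure.pi (fun _ : Fin (N + 1) => gaussMeasure u θ)) ≤ ENNReal.ofReal (∫ w, ‖w - u‖ ^ (m * n) ∂gaussMeasure u θ) := by
  calc ∫⁻ v, ENNReal.ofReal (P m v ^ n) ∂(Measure.pi (fun _ : Fin (N + 1) => gaussMeasure u θ)) ≤ ∫⁻ v, ENNReal.ofReal (P (m * n) v) ∂(Measure.pi (fun _ : Fin (N + 1) => gaussMeasure u θ)) :=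
        lintegral_mono fun v => ENNReal.ofReal_le_ofReal (P_pow_le u c P hc0 hc1 hP m n v)
    _ = _ := by rw [lintegral_P u θ c P hc0 hP, hc1, one_mul]

end Psums

end ProductBasics

/-! ## Registered anchor of this support file -/

/-- ANCHOR (registered helper stub `eqRung_gauss_anchor` of the crux item): the rank-2 traceless test
is centred under the one-particle Gaussian `N(u, θ𝟙)` — the one-particle input of the equilibrium rung. -/
theorem eqRung_gauss_anchor : ∀ (u : V3) (θ : ℝ), 0 < θ → ∀ j l : Fin 3, ∫ v, pairT (C2 j l) (tpow 2 (v - u)) ∂Literature.MathematicalPhysics.KineticTheory.gaussMeasure u θ = 0 :=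
  fun u _ hθ j l => integral_pairT_C2_sub u hθ j l

end EqRung

end

end Summit.AtomisticToContinuum.HydrodynamicLimit.Theorems.ContactBalance
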